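import Mathlib
import Summits.Ventures.HodgeRepro2.JointEigenbasis
import Summits.Ventures.HodgeRepro2.PeterssonSpace

/-!
# FormalAdjointEigenvalue — eigenvalues of a formal adjoint pair on a common eigenvector are
complex conjugates; Hecke eigenvalues of `T_{δ⁻¹}` are the conjugates of those of `T_δ`

Blind cell `pub-hodge-repro2`, seat p2 (Tier 5 kernel support, Hecke side of N3 / N5).

For a formal adjoint pair `(T, T')` (`⟪T x, y⟫ = ⟪x, T' y⟫`) and a non-zero common eigenvector `v`
with `T v = μ • v`, `T' v = ν • v`, one has `ν = conj μ` (compare `⟪T v, v⟫ = conj μ ⟪v, v⟫` with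
`⟪v, T' v⟫ = ν ⟪v, v⟫`). Applied to the Hecke operators on the Petersson space
(`PeterssonSpace.lean`): on a simultaneous eigenform, the eigenvalue of `T_{δ⁻¹}` is the complex
conjugate of the eigenvalue of `T_δ` — the shape of «`a_p(f̄) = \overline{a_p(f)}`» used when the
Hecke eigenvalues of the vertex forms and of their conjugates are compared (N3 / N5).
-/

namespace Summit.Ventures.HodgeRepro2.JointEigenbasis

section general

variable {𝕜 E : Type*} [RCLike 𝕜] [NormedAddCommGroup E] [InnerProductSpace 𝕜 E]

/-- **Eigenvalues of a formal adjoint pair on a common eigenvector are conjugate.** -/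
theorem IsFormalAdjointPair.eigenvalue_eq_conj {T T' : E →ₗ[𝕜] E} (h : IsFormalAdjointPair T T')
    {v : E} (hv : v ≠ 0) {μ ν : 𝕜} (hμ : T v = μ • v) (hν : T' v = ν • v) :
    ν = (starRingEnd 𝕜) μ := by
  have h1 : inner 𝕜 (T v) v = inner 𝕜 v (T' v) := h v v
  rw [hμ, hν, inner_smul_left, inner_smul_right] at h1
  have h2 : inner 𝕜 v v ≠ 0 := inner_self_ne_zero.mpr hv
  exact (mul_right_cancel₀ h2 h1).symm

/-- A symmetric operator has real eigenvalues (restatement of Mathlib's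
`LinearMap.IsSymmetric.conj_eigenvalue_eq_self` through `IsFormalAdjointPair`). -/
theorem IsFormalAdjointPair.eigenvalue_conj_eq_self {T : E →ₗ[𝕜] E} (h : IsFormalAdjointPair T T)
    {v : E} (hv : v ≠ 0) {μ : 𝕜} (hμ : T v = μ • v) : (starRingEnd 𝕜) μ = μ :=
  (h.eigenvalue_eq_conj hv hμ hμ).symm

end general

end Summit.Ventures.HodgeRepro2.JointEigenbasis

namespace Summit.Ventures.HodgeRepro2.ShimuraData

open JointEigenbasis

variable {K : Type*} [Field K] [NumberField K] [NumberField.IsCMField K] {τ₁ : K →+* ℂ}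
  {H : Matrix (Fin 3) (Fin 3) K} {Q : Matrix (Fin 3) (Fin 3) ℂ} (hQ : IsFrame K τ₁ H Q)
  (S : Subgroup (GL (Fin 3) K)) (hS : (S : Set (GL (Fin 3) K)) ⊆ unitaryGroup K H)
  [CompactSpace (ballQuotient hQ S hS)] {D : Set ball₂} (k : ℕ)
  (hD : IsBallFundamentalDomain hQ S hS D)
  {𝔪 : Submodule ℤ (Fin 3 → K)} (h𝔪 : IsLattice K 𝔪) (hS₁ : S ≤ shimuraLevelSubgroup K H 𝔪 1)
  {N' : ℕ} (hN' : N' ≠ 0) (hSN' : shimuraLevelSubgroup K H 𝔪 N' ≤ S) (hDm : MeasurableSet D)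

/-- **Hecke eigenvalues of `T_{δ⁻¹}` are the conjugates of those of `T_δ`** on a non-zero
simultaneous eigenvector of the Petersson space. -/
theorem heckeFamily_inv_eigenvalue_eq_conj (δ : unitaryGroup K H)
    {v : PeterssonSpace hQ S hS k hD} (hv : v ≠ 0) {μ ν : ℂ}
    (hμ : heckeFamily hQ S hS k hD h𝔪 hS₁ hN' hSN' hDm δ v = μ • v)
    (hν : heckeFamily hQ S hS k hD h𝔪 hS₁ hN' hSN' hDm δ⁻¹ v = ν • v) :
    ν = (starRingEnd ℂ) μ :=
  (isFormalAdjointPair_heckeFamily hQ S hS k hD h𝔪 hS₁ hN' hSN' hDm δ).eigenvalue_eq_conj hv hμ hν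

/-- The Hecke eigenvalue of `T_δ + T_{δ⁻¹}` on a simultaneous eigenform is real. -/
theorem heckeFamily_add_inv_eigenvalue_real (δ : unitaryGroup K H)
    {v : PeterssonSpace hQ S hS k hD} (hv : v ≠ 0) {μ ν : ℂ}
    (hμ : heckeFamily hQ S hS k hD h𝔪 hS₁ hN' hSN' hDm δ v = μ • v)
    (hν : heckeFamily hQ S hS k hD h𝔪 hS₁ hN' hSN' hDm δ⁻¹ v = ν • v) :
    (starRingEnd ℂ) (μ + ν) = μ + ν := by
  rw [heckeFamily_inv_eigenvalue_eq_conj hQ S hS k hD h𝔪 hS₁ hN' hSN' hDm δ hv hμ hν, map_add,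
    Complex.conj_conj, add_comm]

end Summit.Ventures.HodgeRepro2.ShimuraData
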